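import Summits.FinalStateConjecture.FinalStateConjecture.Theorems.SeamedChartsExhaust.Negative.KerrSchildTimeFunction
import Literature.Geometry.Lorentzian.KerrConvergenceProofs
import Literature.Geometry.Lorentzian.CausalFutureProofs

/-!
# The jump model: exact Schwarzschild with a discontinuous excision radius
# (negative-side support for crux `stmt-FinalStateConjecture-13551`, route `StarvedNecks`, line `wide-anchoring`)

An `N = 1` instance of `FinalStateDecomposition` whose flat tube radius JUMPS (`JumpModel.decomp`):
ambient spacetime the Schwarzschild Kerr–Schild exterior patch `Kerr.spacetime 1 0 2 = {r > 2}` (mass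
`1`), `O = {r > 2}`, motion `(1, 0)`, identity hole chart, identity flat chart on
`U = {x⁰ > −1, r > ρ(x⁰)}` with `ρ(t) = 101 + √t + 10·𝟙[1 ≤ t]` (upper semicontinuous, so `U` is open;
sublinear — `FinalStateDecomposition` asks nothing more of an excision radius), `τ₀ = 0`. The flat
chart is future oriented (`flat_isFutureDirected`, HonestCore (d)) and SEAMED (8) holds for the radii
`R = ρ + 2` (`seamed8`), which JUMP at hole time `1`; `yJ = (1/4, 105.5, 0, 0)` is flat-late. Consumer:
`FirstContactNeedsContinuity.lean` (continuity of the radii is load-bearing for the landed first-contact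
stub `WideAnchoring.stub_firstContact`). Chart bookkeeping after the disprover's exact Schwarzschild
model (`Cruxes/SeamedChartsExhaust/Disproof.lean` §5, refuter-cdisprove-stmt-FinalStateConjecture-13551-g2-0);
static flow and time function from `Negative/KerrSchildTimeFunction.lean`.
References: Dafermos–Rodnianski, arXiv:0811.0354, §5.1; O'Neill 1983, Ch. 14, pp. 402–403;
Dafermos–Holzegel–Rodnianski–Taylor, arXiv:2104.08222, §1.
-/


noncomputable section

open TopologicalSpace Manifold Filter Topology Set Function
open scoped ContDiff Topology ENNReal Manifold

set_option linter.dupNamespace false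

-- instance search through nested operator types `E4 →L E4 →L E4 →L ℝ` (as in the tree files)
set_option maxSynthPendingDepth 3

namespace Summit.FinalStateConjecture.FinalStateConjecture.Theorems.SeamedChartsExhaust.Negative

open Literature.Geometry.Lorentzian LorentzianMetric

/-- `Kerr.Facts` is inhabited (all three fields are theorems in the tree). [folklore] -/
instance jumpModelKerrFacts : Kerr.Facts :=
  ⟨Kerr.isConnected_region_holds, Kerr.contMDiff_bilin_holds, Kerr.contMDiff_timeVector_holds⟩

namespace JumpModel

/-- The ambient spacetime: the Schwarzschild Kerr–Schild exterior patch `{r > 2}` of mass `1`. -/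
def ST : Spacetime.{0} 4 := Kerr.spacetime 1 0 2 zero_le_one

/-- The continuous part `101 + √t` of the tube radius. -/
def base (t : ℝ) : ℝ := 101 + √t

/-- The JUMPING flat tube radius `ρ(t) = 101 + √t + 10·𝟙[1 ≤ t]` (upper semicontinuous, sublinear). -/
def ρ (t : ℝ) : ℝ := base t + if 1 ≤ t then 10 else 0

/-- The radii `R(s) = ρ(s) + 2` (the least profile SEAMED (8) allows; discontinuous at `s = 1`). -/
def Rj (s : ℝ) : ℝ := ρ s + 2

/-- `base` is continuous. -/
theorem continuous_base : Continuous base := continuous_const.add Real.continuous_sqrt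

/-- `base ≤ ρ`. -/
theorem base_le_ρ (t : ℝ) : base t ≤ ρ t := by unfold ρ; split_ifs <;> linarith

/-- `ρ ≥ 101`. -/
theorem ρ_ge (t : ℝ) : 101 ≤ ρ t :=
  (le_add_of_nonneg_right (Real.sqrt_nonneg t) : (101 : ℝ) ≤ base t).trans (base_le_ρ t)

/-- The flat tubes stay outside the Schwarzschild radius `2`. -/
theorem two_lt_ρ (t : ℝ) : 2 * (1 : ℝ) < ρ t := by linarith [ρ_ge t]

/-- `ρ = base` before the jump. -/
theorem ρ_of_lt_one {t : ℝ} (ht : t < 1) : ρ t = base t := by unfold ρ; rw [if_neg (not_le.mpr ht), add_zero]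

/-- `ρ = base + 10` after the jump. -/
theorem ρ_of_one_le {t : ℝ} (ht : 1 ≤ t) : ρ t = base t + 10 := by unfold ρ; rw [if_pos ht]

/-- `ρ(1/4) = 101.5`. -/
theorem ρ_quarter : ρ (1 / 4) = 203 / 2 := by
  rw [ρ_of_lt_one (by norm_num), base]
  have : √(1 / 4 : ℝ) = 1 / 2 := by
    rw [show (1 / 4 : ℝ) = (1 / 2) ^ 2 by norm_num, Real.sqrt_sq (by norm_num)]
  rw [this]; norm_num

/-- `ρ(1) = 112`. -/
theorem ρ_one : ρ 1 = 112 := by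
  rw [ρ_of_one_le le_rfl, base, Real.sqrt_one]; norm_num

/-- Below hole time `1` the radii are at most `104`. -/
theorem Rj_le_of_lt_one {s : ℝ} (hs : s < 1) : Rj s ≤ 104 := by
  rw [Rj, ρ_of_lt_one hs, base]
  have h1 : √s ≤ 1 := by
    rcases le_or_gt 0 s with h | h
    · calc √s ≤ √1 := Real.sqrt_le_sqrt hs.le
        _ = 1 := Real.sqrt_one
    · rw [Real.sqrt_eq_zero'.mpr h.le]; norm_num
  linarith

/-- The flat coordinate domain `{x⁰ > −1, r > ρ(x⁰)}` is open: it is a union of two open sets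
(`ρ` is upper semicontinuous — it jumps UP at `t = 1` and takes the upper value there). -/
theorem isOpen_U : IsOpen {x : E4 | -1 < x 0 ∧ ρ (x 0) < Kerr.radius 0 x} := by
  have hc0 : Continuous fun x : E4 ↦ x 0 := PiLp.continuous_apply 2 _ 0
  have hb : Continuous fun x : E4 ↦ base (x 0) := continuous_base.comp hc0
  have hEq : {x : E4 | -1 < x 0 ∧ ρ (x 0) < Kerr.radius 0 x} =
      ({x : E4 | -1 < x 0} ∩ {x | x 0 < 1} ∩ {x | base (x 0) < Kerr.radius 0 x}) ∪
        ({x : E4 | -1 < x 0} ∩ {x | base (x 0) + 10 < Kerr.radius 0 x}) := by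
    ext x
    simp only [mem_setOf_eq, mem_union, mem_inter_iff]
    by_cases h : 1 ≤ x 0
    · rw [ρ_of_one_le h]
      exact ⟨fun h' ↦ Or.inr h', fun h' ↦ h'.elim (fun h'' ↦ absurd h''.1.2 (not_lt.mpr h)) id⟩
    · push Not at h
      rw [ρ_of_lt_one h]
      exact ⟨fun h' ↦ Or.inl ⟨⟨h'.1, h⟩, h'.2⟩,
        fun h' ↦ h'.elim (fun h'' ↦ ⟨h''.1.1, h''.2⟩) fun h'' ↦ ⟨h''.1, by linarith [h''.2]⟩⟩
  rw [hEq]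
  exact (((isOpen_lt continuous_const hc0).inter (isOpen_lt hc0 continuous_const)).inter
    (isOpen_lt hb (Kerr.continuous_radius 0))).union
    ((isOpen_lt continuous_const hc0).inter (isOpen_lt (hb.add continuous_const) (Kerr.continuous_radius 0)))

/-- The flat coordinate domain `U = {x⁰ > −1, r > ρ(x⁰)}`. -/
def U : Opens E4 := ⟨{x | -1 < x 0 ∧ ρ (x 0) < Kerr.radius 0 x}, isOpen_U⟩

/-- The Kerr exterior `{r > 2}` is the whole patch. -/
theorem hext : (Kerr.background 1 0).domain ≤ Kerr.region 0 2 := by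
  change Kerr.region 0 (Kerr.rPlus 1 0) ≤ Kerr.region 0 2
  rw [Kerr.rPlus_zero_right zero_le_one, mul_one]

/-- Membership in the Schwarzschild exterior of mass `1`. -/
theorem mem_exterior_iff {x : E4} : x ∈ Kerr.exterior 1 0 ↔ 2 * (1 : ℝ) < Kerr.radius 0 x := by
  rw [Kerr.mem_exterior, Kerr.rPlus_zero_right zero_le_one, max_eq_left (by norm_num)]

/-- Membership in the boosted exterior of the trivial motion. -/
theorem mem_bext_iff {x : E4} : x ∈ boostedKerrExterior 1 0 1 0 ↔ 2 * (1 : ℝ) < Kerr.radius 0 x := by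
  rw [mem_boostedKerrExterior, poincareInv_one_zero, mem_exterior_iff]

/-- The boosted exterior of the trivial motion lies in the patch. -/
theorem hbext : boostedKerrExterior 1 0 1 0 ≤ Kerr.region 0 2 := by
  rw [boostedKerrExterior_one_zero]
  exact hext

/-- The flat domain lies in the Kerr exterior. -/
theorem hUext : (Minkowski.backgroundOn U).domain ≤ (Kerr.background 1 0).domain := by
  intro x hx
  change x ∈ Kerr.exterior 1 0
  rw [mem_exterior_iff]
  exact (two_lt_ρ (x 0)).trans hx.2

/-- The flat domain lies in the patch. -/
theorem hUreg : U ≤ Kerr.region 0 2 := fun _ hx ↦ hext (hUext hx)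

/-- The identity Kerr chart `{r > 2} ↪ {r > 2}`. -/
def ΨK : (Kerr.background 1 0).domain → ST.carrier := Opens.inclusion hext

/-- The hole chart: the identity on the boosted exterior of the trivial motion `(1, 0)`. -/
def Ψ : (boostedKerrBackground 1 0 1 0).domain → ST.carrier := Opens.inclusion hbext

/-- The flat chart: the identity Kerr chart restricted to `U`. -/
def Φ : (Minkowski.backgroundOn U).domain → ST.carrier := ΨK ∘ Opens.inclusion hUext

/-- The region: the Schwarzschild exterior `{r > 2}` (all of the patch). -/
def O : Set ST.carrier := {x | 2 * (1 : ℝ) < Kerr.radius 0 x.1}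

/-- The flat chart is the identity on coordinates. -/
@[simp] theorem Φ_val (y : (Minkowski.backgroundOn U).domain) : (Φ y).1 = y.1 := rfl

/-- The deviation of the identity hole chart from boosted Kerr `(1, 0)` vanishes identically. -/
theorem deviation_Ψ (x : (boostedKerrBackground 1 0 1 0).domain) :
    ST.deviation (boostedKerrBackground 1 0 1 0) Ψ x = 0 := by
  ext v w
  rw [Spacetime.deviation_apply]
  have e1 : mfderiv 𝓘(ℝ, E4) (𝓡 4) Ψ x v = v := OpensChart.mfderiv_inclusion_apply hbext x v
  have e2 : mfderiv 𝓘(ℝ, E4) (𝓡 4) Ψ x w = w := OpensChart.mfderiv_inclusion_apply hbext x w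
  rw [e1, e2]
  change Kerr.bilin 1 0 x.1 v w - boostedKerrBilin 1 0 1 0 x.1 v w = 0
  rw [boostedKerrBilin_one_zero]
  exact sub_self _

/-- Extended-by-zero form of `deviation_Ψ`. -/
theorem deviationExtend_Ψ : ST.deviationExtend (boostedKerrBackground 1 0 1 0) Ψ = 0 := by
  funext z
  by_cases hz : z ∈ (boostedKerrBackground 1 0 1 0).domain
  · have := ST.deviationExtend_coe (boostedKerrBackground 1 0 1 0) Ψ ⟨z, hz⟩
    rw [deviation_Ψ] at this
    exact this
  · exact ST.deviationExtend_of_not_mem _ _ hz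

/-- The deviation of the identity Kerr chart from Kerr vanishes identically. -/
theorem deviation_ΨK (x : (Kerr.background 1 0).domain) :
    ST.deviation (Kerr.background 1 0) ΨK x = 0 := by
  ext v w
  rw [Spacetime.deviation_apply]
  have e1 : mfderiv 𝓘(ℝ, E4) (𝓡 4) ΨK x v = v := OpensChart.mfderiv_inclusion_apply hext x v
  have e2 : mfderiv 𝓘(ℝ, E4) (𝓡 4) ΨK x w = w := OpensChart.mfderiv_inclusion_apply hext x w
  rw [e1, e2]
  exact sub_self _

/-- Extended-by-zero form of `deviation_ΨK`. -/
theorem deviationExtend_ΨK : ST.deviationExtend (Kerr.background 1 0) ΨK = 0 := by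
  funext z
  by_cases hz : z ∈ (Kerr.background 1 0).domain
  · have := ST.deviationExtend_coe (Kerr.background 1 0) ΨK ⟨z, hz⟩
    rw [deviation_ΨK] at this
    exact this
  · exact ST.deviationExtend_of_not_mem _ _ hz

/-- Late-time chart property of an inclusion of open subsets of `E4` into the patch. -/
theorem isLateChart_inclusion (B : ModelBackground) (hV : B.domain ≤ Kerr.region 0 2)
    (htime : Continuous B.time)
    (hO : ∀ x : B.domain, 0 < B.time x.1 → 2 * (1 : ℝ) < Kerr.radius 0 x.1) :
    ST.IsLateChart B O 0 (Opens.inclusion hV : B.domain → ST.carrier) := by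
  refine ⟨contMDiff_inclusion (n := ∞) hV, ?_, ?_⟩
  · have hlate : IsOpen (B.lateRegion 0) :=
      isOpen_lt continuous_const (htime.comp continuous_subtype_val)
    have hg : IsOpenEmbedding (fun x : B.lateRegion 0 ↦ (x.1.1 : E4)) :=
      B.domain.2.isOpenEmbedding_subtypeVal.comp hlate.isOpenEmbedding_subtypeVal
    have hcar : IsOpenEmbedding (Subtype.val : ST.carrier → E4) :=
      (Kerr.region 0 2).2.isOpenEmbedding_subtypeVal
    exact IsOpenEmbedding.of_comp _ hcar hg
  · rintro _ ⟨x, hx, rfl⟩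
    exact hO x hx

/-- The identity Kerr chart is a late-time chart into `O`. -/
theorem isLateChart_ΨK : ST.IsLateChart (Kerr.background 1 0) O 0 ΨK :=
  isLateChart_inclusion _ hext (PiLp.continuous_apply 2 _ 0) fun x _ ↦ mem_exterior_iff.mp x.2

/-- The hole chart is a late-time chart into `O`. -/
theorem isLateChart_Ψ : ST.IsLateChart (boostedKerrBackground 1 0 1 0) O 0 Ψ :=
  isLateChart_inclusion _ hbext ((PiLp.continuous_apply 2 _ 0).comp (continuous_poincareInv 1 0))
    fun x _ ↦ mem_bext_iff.mp x.2

/-- The flat chart is a late-time chart into `O`. -/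
theorem isLateChart_Φ : ST.IsLateChart (Minkowski.backgroundOn U) O 0 Φ :=
  ST.isLateChart_backgroundOn_comp_inclusion isLateChart_ΨK hUext

/-- The `Cᵏ` deviation of the identity Kerr chart vanishes. -/
theorem deviationCk_ΨK (k : ℕ) (τ : ℝ) : ST.deviationCk (Kerr.background 1 0) ΨK k τ = 0 := by
  rw [Spacetime.deviationCk, deviationExtend_ΨK, supCkENorm_zero]

/-- The truncated `Cᵏ` deviation of the hole chart vanishes. -/
theorem truncDeviationCk_Ψ (k : ℕ) (R τ : ℝ) :
    ST.truncDeviationCk (boostedKerrBackground 1 0 1 0) Ψ k R τ = 0 := by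
  rw [Spacetime.truncDeviationCk, deviationExtend_Ψ, supCkENorm_zero]

/-- `ρ → ∞`. -/
theorem ρ_tendsto_atTop : Tendsto ρ atTop atTop :=
  tendsto_atTop_mono base_le_ρ (tendsto_atTop_add_const_left _ _ Real.tendsto_sqrt_atTop)

/-- Sublinearity of the jumping radius: `ρ(t)/t → 0`. -/
theorem ρ_div_tendsto : Tendsto (fun t ↦ ρ t / t) atTop (𝓝 0) := by
  have h1 : Tendsto (fun t : ℝ ↦ (111 : ℝ) / t) atTop (𝓝 0) :=
    tendsto_const_nhds.div_atTop tendsto_id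
  have h2 : Tendsto (fun t : ℝ ↦ √t / t) atTop (𝓝 0) := by
    simp_rw [Real.sqrt_div_self]
    exact tendsto_inv_atTop_zero.comp Real.tendsto_sqrt_atTop
  refine (add_zero (0 : ℝ) ▸ h1.add h2).congr' ?_
  filter_upwards [eventually_ge_atTop (1 : ℝ)] with t ht
  rw [ρ_of_one_le ht, base]; ring

/-- The vertical translate `x + s ∂₀` as a point of the patch (the radius is unchanged). -/
def up (x : ST.carrier) (s : ℝ) : ST.carrier :=
  ⟨x.1 + s • E4.basisVector 0, by
    show max 2 0 < Kerr.radius 0 (x.1 + s • E4.basisVector 0)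
    rw [Kerr.radius_add_time_smul_basisVector]; exact x.2⟩

/-- Time along the vertical translate. -/
theorem up_zero_apply (x : ST.carrier) (s : ℝ) : (up x s).1 0 = x.1 0 + s := by simp [up]

/-- Radius along the vertical translate. -/
theorem radius_up (x : ST.carrier) (s : ℝ) : Kerr.radius 0 (up x s).1 = Kerr.radius 0 x.1 :=
  Kerr.radius_add_time_smul_basisVector _ _ _

/-- The static flow is causal (`Schw.vertical_mem_causalFuture`), past form. -/
theorem mem_causalPast_up (x : ST.carrier) (hx : x ∈ O) {s : ℝ} (hs : 0 ≤ s) :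
    x ∈ ST.metric.causalPast ST.timeOrientation {up x s} :=
  mem_causalPast_of_mem_causalFuture (Schw.vertical_mem_causalFuture (hM := zero_le_one) x hx hs _)

/-- A point of the exterior with coordinate `y ∈ E4` is the hole-chart image of `y`. -/
theorem eq_Ψ (x : ST.carrier) (hx : x ∈ O) :
    ∃ hx' : x.1 ∈ (boostedKerrBackground 1 0 1 0).domain, Ψ ⟨x.1, hx'⟩ = x :=
  ⟨mem_bext_iff.mpr hx, Subtype.ext rfl⟩

/-- The `N = 1` exact Schwarzschild decomposition of the exterior `O = {r > 2}`: motion `(1, 0)`,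
identity hole chart, flat chart the identity on `U = {x⁰ > −1, r > ρ(x⁰)}` with the JUMPING excision
radius `ρ`, `τ₀ = 0`. -/
def decomp : FinalStateDecomposition ST O 2 where
  N := 1
  mass _ := 1
  spin _ := 0
  mass_pos _ := one_pos
  abs_spin_le_mass _ := by rw [abs_zero]; exact zero_le_one
  motion _ := (1, 0)
  τ₀ := 0
  chart _ := Ψ
  isLateChart _ := isLateChart_Ψ
  tendsto_truncDeviationCk _ R := by
    simp_rw [truncDeviationCk_Ψ]
    exact tendsto_const_nhds
  exists_pairwise_disjoint _ := ⟨0, Subsingleton.pairwise⟩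
  excision _ := ρ
  tendsto_excision_div _ := ρ_div_tendsto
  flatDomain := U
  setOf_lt_excision_subset_flatDomain := by
    rintro x ⟨hx0, hx⟩
    have h := hx 0
    rw [poincareInv_one_zero] at h
    exact ⟨by linarith, h⟩
  flatChart := Φ
  isLateChart_flat := isLateChart_Φ
  tendsto_deviationCk_flat := by
    refine ST.tendsto_deviationCk_backgroundOn isLateChart_ΨK.contMDiff ?_
      ρ_tendsto_atTop (fun z (hz : z ∈ U) ↦ hz.2) hUext
    simp_rw [deviationCk_ΨK]
    exact tendsto_const_nhds
  diff_subset_causalPast := by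
    rintro p ⟨hpO, hpn⟩
    have hp0 : p.1 0 ≤ 0 := by
      by_contra h
      push Not at h
      apply hpn
      refine Or.inl (mem_iUnion.mpr ⟨0, ?_⟩)
      obtain ⟨hp', hpeq⟩ := eq_Ψ p hpO
      refine ⟨⟨p.1, hp'⟩, ?_, hpeq⟩
      show 0 < poincareInv 1 0 p.1 0
      rwa [poincareInv_one_zero]
    set s : ℝ := -p.1 0 with hs
    have hs0 : 0 ≤ s := by linarith
    refine causalFuture_mono (singleton_subset_iff.mpr ?_) (mem_causalPast_up p hpO hs0)
    refine Or.inl (mem_iUnion.mpr ⟨(0 : Fin 1), ?_⟩)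
    have hqO : up p s ∈ O := by show 2 * (1 : ℝ) < _; rw [radius_up]; exact hpO
    obtain ⟨hq', hqeq⟩ := eq_Ψ (up p s) hqO
    refine ⟨⟨(up p s).1, hq'⟩, ?_, hqeq⟩
    show poincareInv 1 0 (up p s).1 0 = 0
    rw [poincareInv_one_zero, up_zero_apply, hs]
    ring

/-- The hole background of the model. -/
theorem decomp_background (i : Fin decomp.N) :
    decomp.background i = boostedKerrBackground 1 0 1 0 := rfl

/-- The excision radius of the model. -/
theorem decomp_excision (i : Fin decomp.N) : decomp.excision i = ρ := rfl

/-- Hole time is coordinate time. -/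
@[simp] theorem bg_time (x : E4) : (boostedKerrBackground 1 0 1 0).time x = x 0 := by
  show poincareInv 1 0 x 0 = x 0
  rw [poincareInv_one_zero]

/-- Hole radius is the Kerr–Schild radius. -/
@[simp] theorem bg_radius (x : E4) :
    (boostedKerrBackground 1 0 1 0).radius x = Kerr.radius 0 x := by
  show Kerr.radius 0 (poincareInv 1 0 x) = _
  rw [poincareInv_one_zero]

/-- Flat-domain points are exterior points. -/
theorem Φ_mem_O (y : (Minkowski.backgroundOn U).domain) : Φ y ∈ O :=
  (two_lt_ρ (y.1 0)).trans y.2.2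

/-- `HonestCore` (d) in the model: the flat chart is future oriented (the static flow). -/
theorem flat_isFutureDirected (y : decomp.flatDomain) (_hy : decomp.τ₀ < y.1 0) :
    ST.timeOrientation.IsFutureDirected (mfderiv 𝓘(ℝ, E4) (𝓡 4) decomp.flatChart y (E4.basisVector 0)) :=
  (congrArg (fun w : E4 ↦ ST.timeOrientation.IsFutureDirected (x := Φ y) w)
    (OpensChart.mfderiv_inclusion_apply hUreg y (E4.basisVector 0))).mpr
      (Schw.isFutureDirected_e0 (hM := zero_le_one) (Φ y) (Φ_mem_O y))

/-- SEAMED (8) in the model for the radii `R = ρ + 2` (with equality on the tube walls). -/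
theorem seamed8 (j : Fin decomp.N) (y : E4) (_hy : decomp.τ₀ ≤ y 0)
    (hr : (decomp.background j).radius y ≤ decomp.excision j (y 0)) :
    (decomp.background j).radius y + 2 ≤ Rj ((decomp.background j).time y) := by
  rw [decomp_background, bg_radius, bg_time, Rj]
  rw [decomp_background, bg_radius, decomp_excision] at hr
  linarith

/-- The flat-late point `y = (1/4, ρ(1/4) + 4, 0, 0) = (1/4, 105.5, 0, 0)`. -/
def yJ : E4 := E4.ofTimeSpace (1 / 4) ((211 / 2 : ℝ) • EuclideanSpace.single (0 : Fin 3) (1 : ℝ))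

/-- `y⁰ = 1/4`. -/
theorem yJ_zero : yJ 0 = 1 / 4 := E4.ofTimeSpace_apply_zero _ _

/-- `‖y̲‖ = 105.5`. -/
theorem spatialNorm_yJ : E4.spatialNorm yJ = 211 / 2 := by
  rw [yJ, E4.spatialNorm_ofTimeSpace, norm_smul, Real.norm_eq_abs, abs_of_pos (by norm_num)]
  simp

/-- `r(y) = 105.5`. -/
theorem radius_yJ : Kerr.radius 0 yJ = 211 / 2 := by rw [Kerr.radius_zero_left, spatialNorm_yJ]

/-- `y` lies in the flat domain (`r(y) = ρ(1/4) + 4`). -/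
theorem yJ_mem_U : yJ ∈ U := by
  refine ⟨by rw [yJ_zero]; norm_num, ?_⟩
  rw [radius_yJ, yJ_zero, ρ_quarter]
  norm_num

end JumpModel

end Summit.FinalStateConjecture.FinalStateConjecture.Theorems.SeamedChartsExhaust.Negative

end
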